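import Literature.AlgebraicGeometry.HodgeTheory.WeightCocharacterHodgeGroupKernel
import Literature.AlgebraicGeometry.Deligne1982.WeilTypeCMMumfordTateGroupMeetUnitaryGroup
import Literature.AlgebraicGeometry.Deligne1982.WeilTypeCMGeneralMemberLefschetzGroupOnH1
import Literature.AlgebraicGeometry.VanGeemen1994.WeilTypeGeneralMemberMumfordTateGroupOnH1
import HarnessLib

/-!
# `Hg = MT ∩ ker l` and `L = MT · ker l`: the Mumford–Tate group meets Milne's Lefschetz groups

Milne [Milne1999LefschetzClasses, §4 p. 659]: «the homomorphism `a ↦ (a⁻¹, a⁻²) : 𝔾_m → GL(V(A)) × 𝔾_m` takes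
values in `L(A)`. Therefore `L(A)` has a canonical cocharacter `w` … `l ∘ w = -2` … the kernel of `l(A)`, regarded as
a subgroup of `GL(V(A))`, equals `S(A)`»; p. 660: «Clearly `D_hom(A) ⊂ H(A)`, and so `L(A) ⊃ Hg(A)`», and Prop. 4.8
(«`Hg(A) = L(A)` ⟺ `Hg′(A) = S(A)`», the five lemma on `0 → Hg′ → Hg → 𝔾_m → 0` over `0 → S → L → 𝔾_m → 0`).
Deligne [Deligne1982HodgeCycles, I Prop. 3.4 and 3.6] / Lange [Lange2023AbelianVarietiesComplex, Rem. 7.2.2 (2)]: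
`MT = 𝔾_m · Hg`. Milne [Milne2025AbelianMotivesCharP, §1.5 Example 1.17]: the square `SU(φ) ↪ MT(A)` over
`GU(φ) ↪ L(A)` for an abelian variety of Weil type.

This file (all `theorem`s, no definition, no named fact) records the PULL-BACK SQUARE behind these sentences on the
tree's carriers (`HodgeTheory.hodgeGroup` / `mumfordTateGroup`, `Milne1999.specialLefschetzGroup` / `lefschetzGroup`,
`weightCocharacter`; on `H¹`: `VanGeemen1994.hodgeGroupOne`, Milne's `S(A)(ℂ) = unitaryCentralizerGroup A h`,
`G(A)(ℂ) = similitudeCentralizerGroup A h`):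
* **families, every smooth projective `X` of positive dimension**: `MT(X) ⊓ ker l = Hg(X)` and `MT(X) ⊔ ker l = L`
  (`w(c) ∈ ker l ⇒ c² = 1 ⇒ w(c) ∈ Hg`, the tree's `weightCocharacter_mem_hodgeGroup_iff`); hence
  `ker l ≤ MT ⟺ Hg = ker l ⟺ MT = L` (Prop. 4.8 (b) ⟺ (c) as lattice identities);
* **on `H¹` of every complex abelian variety** `A` of positive dimension with a polarization class `h`:
  `MT(A)(ℂ)|_{H¹} ⊓ S(A)(ℂ) = Hg(A)(ℂ)|_{H¹}` (a scalar in `S(A)(ℂ)` is `±1 ∈ Hg(A)(ℂ)|_{H¹}`), without any `h`: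
  `MT(A)(ℂ)|_{H¹} ⊓ {g₁ | g ∈ ker l(A)(ℂ)} = Hg(A)(ℂ)|_{H¹}` (Thm. 4.4 on `H¹`), and
  `MT(A)(ℂ)|_{H¹} ⊔ S(A)(ℂ) = G(A)(ℂ) = L(A)(ℂ)|_{H¹}`; so `S(A) ≤ MT|_{H¹} ⟺ Hg|_{H¹} = S(A) ⟺ MT|_{H¹} = G(A)`;
* **Weil type**: for EVERY `(A, η, h)` (CM field, `U(φ)(ℂ) = weilUnitaryGroupCM`) and every `(A, φ, h_K)` with
  `dim A = 2n` (`K = ℚ(√-d)`, van Geemen's `U_H(ℂ)`): `MT(A)(ℂ)|_{H¹} ⊓ U(φ)(ℂ) = Hg(A)(ℂ)|_{H¹}` — so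
  «`Hg = SU(φ)`» is EQUIVALENT to «`MT|_{H¹} ∩ U(φ) = SU(φ)`», and for the general member `MT|_{H¹} ⊔ U(φ) = G(A)`:
  both rows of Milne's diagram and the two maps between them, on `H¹`.

## References

* [Milne1999LefschetzClasses] J. S. Milne, *Lefschetz classes on abelian varieties*, Duke Math. J. 96 (1999), §4
  pp. 659–660 (the cocharacters `w`, `l`; `l ∘ w = -2`; `ker l(A) = S(A)`; `L(A) ⊃ Hg(A)`), Thm. 4.4, Prop. 4.8.
* [Deligne1982HodgeCycles] P. Deligne (notes by J. S. Milne), *Hodge cycles on abelian varieties*, LNM 900 (1982),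
  I Prop. 3.4 and 3.6.
* [Lange2023AbelianVarietiesComplex] H. Lange, *Abelian Varieties over the Complex Numbers* (2023), Rem. 7.2.2 (2).
* [Milne2025AbelianMotivesCharP] J. S. Milne, *Abelian motives in characteristic p*, arXiv:2508.09972, §1.5 Ex. 1.17.
* [vanGeemen1994HodgeAV] B. van Geemen, LNM 1594 (1994), Lemma 5.2, 6.9, Lemma 6.10, Thm. 6.11.
* [VoisinHodgeI2002] C. Voisin, *Hodge Theory and Complex Algebraic Geometry I* (2002), §7.1.2, Thm. 11.30.
-/

noncomputable section

open CategoryTheory Polynomial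
open Literature.AlgebraicTopology.SingularHomology
open Literature.AlgebraicGeometry.Motives
open Literature.AlgebraicGeometry.HodgeTheory
open Literature.AlgebraicGeometry.VanGeemen1994
open Literature.AlgebraicGeometry.Milne1999
open Literature.AlgebraicGeometry.Deligne1982

/-! ### §1 Families: `MT ⊓ ker l = Hg`, `MT ⊔ ker l = L` on every smooth projective `X` -/

namespace Literature.AlgebraicGeometry.HodgeTheory

section Generic

variable {n : ℕ} {X : SchemeOver ℂ}

/-- **`MT(X) ⊓ U = Hg(X)` for every subgroup `U` between `Hg(X)` and «scalars only `±1`»**: if `Hg(X)(ℂ) ≤ U` and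
`w(c) ∈ U` forces `c² = 1`, then `MT(X)(ℂ) ∩ U = Hg(X)(ℂ)` (`m = w(c) · g`, `g ∈ Hg ≤ U`, so `w(c) = m g⁻¹ ∈ U`,
`c² = 1`, `w(c) ∈ Hg`). [cite: Milne1999LefschetzClasses, §4 p. 659 (l ∘ w = -2) and p. 660 (L(A) ⊃ Hg(A))]
[cite: Deligne1982HodgeCycles, I Prop. 3.4 and 3.6] -/
theorem mumfordTateGroup_inf_eq_hodgeGroup_of_le (hX : IsSmoothProjective n X) (hn : 1 ≤ n)
    {U : Subgroup (∀ k : ℕ, complexBetti X k ≃ₗ[ℂ] complexBetti X k)} (hle : hodgeGroup n X ≤ U)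
    (hw : ∀ c : ℂˣ, weightCocharacter X c ∈ U → (c : ℂ) ^ 2 = 1) :
    mumfordTateGroup n X ⊓ U = hodgeGroup n X := by
  refine le_antisymm ?_ (le_inf hodgeGroup_le_mumfordTateGroup hle)
  rintro m ⟨hm, hU⟩
  obtain ⟨c, g, hg, rfl⟩ := mem_mumfordTateGroup_iff_exists_weightCocharacter_mul.1 hm
  have hwU : weightCocharacter X c ∈ U := by
    have e : weightCocharacter X c = weightCocharacter X c * g * g⁻¹ := (mul_inv_cancel_right _ _).symm
    rw [e]
    exact U.mul_mem hU (U.inv_mem (hle hg))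
  exact (hodgeGroup n X).mul_mem ((weightCocharacter_mem_hodgeGroup_iff hX hn).2 (hw c hwU)) hg

/-- **`Hg(X) = MT(X) ∩ ker l`** for every smooth projective `X` of positive dimension: an element of the Mumford–Tate
group fixing all Lefschetz classes on all powers lies in the Hodge group (`w(c) ∈ ker l ⟺ c² = 1 ⟺ w(c) ∈ Hg`,
Milne's `l ∘ w = -2`). [cite: Milne1999LefschetzClasses, §4 pp. 659–660 (l ∘ w = -2, ker l(A) = S(A), L(A) ⊃ Hg(A)) and Prop. 4.8]
[cite: Deligne1982HodgeCycles, I Prop. 3.4 and 3.6] -/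
theorem mumfordTateGroup_inf_specialLefschetzGroup_eq_hodgeGroup (hX : IsSmoothProjective n X) (hn : 1 ≤ n) :
    mumfordTateGroup n X ⊓ specialLefschetzGroup n X = hodgeGroup n X :=
  mumfordTateGroup_inf_eq_hodgeGroup_of_le hX hn (hodgeGroup_le_specialLefschetzGroup hX)
    fun _ hw ↦ (weightCocharacter_mem_specialLefschetzGroup_iff hX hn).1 hw

/-- `g ∈ Hg(X)(ℂ)` iff `g ∈ MT(X)(ℂ)` and `g` fixes every Lefschetz class on every power.
[cite: Milne1999LefschetzClasses, §4 pp. 659–660 and Prop. 4.8] -/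
theorem mem_hodgeGroup_iff_mem_mumfordTateGroup_and_mem_specialLefschetzGroup (hX : IsSmoothProjective n X)
    (hn : 1 ≤ n) {g : ∀ k : ℕ, complexBetti X k ≃ₗ[ℂ] complexBetti X k} :
    g ∈ hodgeGroup n X ↔ g ∈ mumfordTateGroup n X ∧ g ∈ specialLefschetzGroup n X := by
  rw [← mumfordTateGroup_inf_specialLefschetzGroup_eq_hodgeGroup hX hn, Subgroup.mem_inf]

/-- **`L = MT · ker l`** for every smooth projective `X`: `MT(X) ⊔ ker l = L` as subgroups of `∏ₖ GL(Hᵏ)`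
(`L = w(ℂˣ) · ker l` and `w(ℂˣ) ≤ MT ≤ L`). [cite: Milne1999LefschetzClasses, §4 p. 659 (L = w·ker l, l ∘ w = -2) and p. 660 (L(A) ⊃ Hg(A))] -/
theorem mumfordTateGroup_sup_specialLefschetzGroup_eq_lefschetzGroup (hX : IsSmoothProjective n X) :
    mumfordTateGroup n X ⊔ specialLefschetzGroup n X = lefschetzGroup n X := by
  refine le_antisymm (sup_le (mumfordTateGroup_le_lefschetzGroup hX) specialLefschetzGroup_le_lefschetzGroup) ?_
  intro g hg
  obtain ⟨c, g', hg', rfl⟩ := mem_lefschetzGroup_iff_exists_weightCocharacter_mul.1 hg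
  exact (mumfordTateGroup n X ⊔ specialLefschetzGroup n X).mul_mem
    (Subgroup.mem_sup_left (weightCocharacter_mem_mumfordTateGroup c)) (Subgroup.mem_sup_right hg')

/-- **`ker l ≤ MT(X) ⟺ Hg(X) = ker l`** (`dim X ≥ 1`): Milne's Prop. 4.8 (c) as a lattice statement.
[cite: Milne1999LefschetzClasses, Prop. 4.8 (p. 660)] -/
theorem specialLefschetzGroup_le_mumfordTateGroup_iff (hX : IsSmoothProjective n X) (hn : 1 ≤ n) :
    specialLefschetzGroup n X ≤ mumfordTateGroup n X ↔ hodgeGroup n X = specialLefschetzGroup n X := by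
  constructor
  · intro h
    rw [← mumfordTateGroup_inf_specialLefschetzGroup_eq_hodgeGroup hX hn]
    exact inf_eq_right.2 h
  · intro h
    rw [← h]
    exact hodgeGroup_le_mumfordTateGroup

/-- **`ker l ≤ MT(X) ⟺ MT(X) = L`**: Milne's Prop. 4.8 (b) as a lattice statement.
[cite: Milne1999LefschetzClasses, Prop. 4.8 (p. 660)] -/
theorem specialLefschetzGroup_le_mumfordTateGroup_iff_mumfordTateGroup_eq (hX : IsSmoothProjective n X) :
    specialLefschetzGroup n X ≤ mumfordTateGroup n X ↔ mumfordTateGroup n X = lefschetzGroup n X := by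
  rw [← mumfordTateGroup_sup_specialLefschetzGroup_eq_lefschetzGroup hX, eq_comm, sup_eq_left]

end Generic

end Literature.AlgebraicGeometry.HodgeTheory

/-! ### §2 Abelian varieties, on `H¹`: `MT(A)(ℂ)|_{H¹} ⊓ S(A)(ℂ) = Hg(A)(ℂ)|_{H¹}`, `MT(A)(ℂ)|_{H¹} ⊔ S(A)(ℂ) = G(A)(ℂ)` -/

namespace Literature.AlgebraicGeometry.Milne1999

variable {A : AbelianVariety ℂ} {h : complexBetti A.X 2}

/-- The scalar automorphism `c · 1`, evaluated. [folklore] -/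
private theorem smulOfUnit_apply₁ (c : ℂˣ) (x : complexBetti A.X 1) :
    LinearEquiv.smulOfUnit c x = (c : ℂ) • x := by
  simp [LinearEquiv.smulOfUnit, Units.smul_def]

/-- A polarization class (`HodgeTheory.IsPolarizationClass`: rational, supported on a divisor, hard Lefschetz) of
an abelian variety lies in `B¹(A) ⊗ ℂ` (algebraic classes are of Hodge type `(1,1)`).
[cite: VoisinHodgeI2002, §7.1.2 and Thm. 11.30] -/
theorem _root_.Literature.AlgebraicGeometry.HodgeTheory.IsPolarizationClass.mem_hodgeClassSpan_one
    (hpol : IsPolarizationClass A.dim A.X h) : h ∈ hodgeClassSpan A.dim A.X 1 :=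
  Submodule.subset_span ⟨hpol.isRationalClass,
    isOfHodgeType_of_mem_algebraicClasses_of_isSmoothProjective AbelianVariety.isSmoothProjective_holds 1
      hpol.mem_algebraicClasses⟩

/-- **`MT(A)(ℂ)|_{H¹} ⊓ U = Hg(A)(ℂ)|_{H¹}` for every subgroup `U ≤ GL(H¹(A(ℂ); ℂ))` between `Hg(A)(ℂ)|_{H¹}` and
«scalars only `±1`»** (`dim A ≥ 1`): `u = c · g` with `g ∈ Hg|_{H¹} ≤ U`, so `c · 1 = u g⁻¹ ∈ U`, `c² = 1`, and
`c · 1 = ±1 ∈ Hg(A)(ℂ)|_{H¹}` (`smulOfUnit_mem_hodgeGroupOne_iff`). [cite: Milne1999LefschetzClasses, §4 pp. 659–660 (l ∘ w = -2, L(A) ⊃ Hg(A))]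
[cite: Lange2023AbelianVarietiesComplex, Rem. 7.2.2 (2)] -/
theorem map_mumfordTateGroup_inf_eq_hodgeGroupOne_of_le (hA : 1 ≤ A.dim)
    {U : Subgroup (complexBetti A.X 1 ≃ₗ[ℂ] complexBetti A.X 1)} (hle : hodgeGroupOne A.dim A.X ≤ U)
    (hsc : ∀ c : ℂˣ, LinearEquiv.smulOfUnit c ∈ U → (c : ℂ) ^ 2 = 1) :
    (mumfordTateGroup A.dim A.X).map
        (Pi.evalMonoidHom (fun k : ℕ ↦ complexBetti A.X k ≃ₗ[ℂ] complexBetti A.X k) 1) ⊓ U =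
      hodgeGroupOne A.dim A.X := by
  refine le_antisymm ?_ (le_inf hodgeGroupOne_le_map_mumfordTateGroup hle)
  rintro u ⟨hm, hU⟩
  obtain ⟨c, g, hg, rfl⟩ := mem_map_mumfordTateGroup_one_iff.1 hm
  have hcU : LinearEquiv.smulOfUnit c ∈ U := by
    have e : (LinearEquiv.smulOfUnit c : complexBetti A.X 1 ≃ₗ[ℂ] complexBetti A.X 1) =
        LinearEquiv.smulOfUnit c * g * g⁻¹ := (mul_inv_cancel_right _ _).symm
    rw [e]
    exact U.mul_mem hU (U.inv_mem (hle hg))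
  exact (hodgeGroupOne A.dim A.X).mul_mem ((smulOfUnit_mem_hodgeGroupOne_iff hA).2 (hsc c hcU)) hg

/-- **`Hg(A)(ℂ)|_{H¹} = MT(A)(ℂ)|_{H¹} ∩ S(A)(ℂ)` FOR EVERY COMPLEX ABELIAN VARIETY** of positive dimension and every
polarization class `h`: an automorphism of `H¹(A(ℂ); ℂ)` coming from the Mumford–Tate group which commutes with
`End(A)` and preserves `Q_h` comes from the Hodge group — on `H¹`, `Hg′(A) = MT(A) ∩ ker l(A)` (`l ∘ w = -2`,
`ker l = S(A)`, `L(A) ⊃ Hg(A)`). [cite: Milne1999LefschetzClasses, §4 pp. 659–660 (l ∘ w = -2, ker l(A) = S(A), L(A) ⊃ Hg(A)) and Prop. 4.8]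
[cite: Deligne1982HodgeCycles, I Prop. 3.4 and 3.6] -/
theorem map_mumfordTateGroup_inf_unitaryCentralizerGroup_eq_hodgeGroupOne (hpol : IsPolarizationClass A.dim A.X h)
    (hA : 1 ≤ A.dim) :
    (mumfordTateGroup A.dim A.X).map
        (Pi.evalMonoidHom (fun k : ℕ ↦ complexBetti A.X k ≃ₗ[ℂ] complexBetti A.X k) 1) ⊓
        unitaryCentralizerGroup A h = hodgeGroupOne A.dim A.X :=
  map_mumfordTateGroup_inf_eq_hodgeGroupOne_of_le hA (hodgeGroupOne_le_unitaryCentralizerGroup hpol.mem_hodgeClassSpan_one)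
    fun _ hc ↦ (smulOfUnit_mem_unitaryCentralizerGroup_iff hpol hA).1 hc

/-- `u ∈ Hg(A)(ℂ)|_{H¹}` iff `u ∈ MT(A)(ℂ)|_{H¹}` and `u ∈ S(A)(ℂ)` (polarization class `h`, `dim A ≥ 1`).
[cite: Milne1999LefschetzClasses, §4 pp. 659–660 and Prop. 4.8] -/
theorem mem_hodgeGroupOne_iff_mem_map_mumfordTateGroup_and_mem_unitaryCentralizerGroup
    (hpol : IsPolarizationClass A.dim A.X h) (hA : 1 ≤ A.dim) {u : complexBetti A.X 1 ≃ₗ[ℂ] complexBetti A.X 1} :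
    u ∈ hodgeGroupOne A.dim A.X ↔
      u ∈ (mumfordTateGroup A.dim A.X).map
          (Pi.evalMonoidHom (fun k : ℕ ↦ complexBetti A.X k ≃ₗ[ℂ] complexBetti A.X k) 1) ∧
        u ∈ unitaryCentralizerGroup A h := by
  rw [← map_mumfordTateGroup_inf_unitaryCentralizerGroup_eq_hodgeGroupOne hpol hA, Subgroup.mem_inf]

/-- **`c · 1 ∈ S(A)(ℂ)` iff `c² = 1`** in the Kähler spelling of the polarization (`h` with `s · h` Kähler for a real
`s ≠ 0`, `dim A ≥ 1`): `Q_h(cx, cy) = c² Q_h(x, y)` and `Q_h` is non-degenerate (hard Lefschetz for the Kähler class,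
the tree's `eq_zero_of_forall_polarizationPairingOne_eq_zero_of_isKaehlerClass_smul'`).
[cite: Milne1999LefschetzClasses, §4 p. 659 (l ∘ w = -2, ker l(A) = S(A))] [cite: VoisinHodgeI2002, Thm. 6.25 and §7.1.2] -/
theorem smulOfUnit_mem_unitaryCentralizerGroup_iff_of_isKaehlerClass {s : ℝ} (hs : s ≠ 0)
    (hK : IsKaehlerClass A.dim A.X ((s : ℂ) • h)) (hA : 1 ≤ A.dim) {c : ℂˣ} :
    LinearEquiv.smulOfUnit c ∈ unitaryCentralizerGroup A h ↔ (c : ℂ) ^ 2 = 1 := by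
  classical
  constructor
  · rintro ⟨-, hQ⟩
    by_contra hc
    have hzero : ∀ x y, polarizationPairingOne A.X h (A.dim - 1) x y = 0 := by
      intro x y
      have e := hQ x y
      rw [smulOfUnit_apply₁, smulOfUnit_apply₁, map_smul, map_smul, LinearMap.smul_apply, smul_smul, ← sq] at e
      have e3 : ((c : ℂ) ^ 2 - 1) • polarizationPairingOne A.X h (A.dim - 1) x y = 0 := by
        rw [sub_smul, one_smul, e, sub_self]
      exact (smul_eq_zero.1 e3).resolve_left (sub_ne_zero.2 hc)
    haveI := finite_complexBetti_abelianVariety A 1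
    have hV : Module.finrank ℂ (complexBetti A.X 1) = 2 * A.dim := AbelianVariety.finrank_complexBetti_one A
    obtain ⟨x, hx⟩ : ∃ x : complexBetti A.X 1, x ≠ 0 := by
      by_contra hall
      haveI : Subsingleton (complexBetti A.X 1) :=
        subsingleton_of_forall_eq 0 fun x ↦ not_not.1 (not_exists.1 hall x)
      have h0 : Module.finrank ℂ (complexBetti A.X 1) = 0 := Module.finrank_zero_of_subsingleton
      omega
    exact hx (eq_zero_of_forall_polarizationPairingOne_eq_zero_of_isKaehlerClass_smul' hs hK x fun y ↦ hzero x y)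
  · intro hc
    refine ⟨(smulOfUnit_mem_similitudeCentralizerGroup A h c).1, fun x y ↦ ?_⟩
    rw [smulOfUnit_apply₁, smulOfUnit_apply₁, map_smul, map_smul, LinearMap.smul_apply, smul_smul, ← sq, hc,
      one_smul]

/-- **`MT(A)(ℂ)|_{H¹} ⊓ S(A)(ℂ) = Hg(A)(ℂ)|_{H¹}`** in the Kähler spelling of the polarization (`h` rational with
`s · h` Kähler, `s ≠ 0`; `dim A ≥ 1`). [cite: Milne1999LefschetzClasses, §4 pp. 659–660 (l ∘ w = -2, ker l(A) = S(A), L(A) ⊃ Hg(A)) and Prop. 4.8] -/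
theorem map_mumfordTateGroup_inf_unitaryCentralizerGroup_eq_hodgeGroupOne_of_isKaehlerClass (hQ : IsRationalClass h)
    {s : ℝ} (hs : s ≠ 0) (hK : IsKaehlerClass A.dim A.X ((s : ℂ) • h)) (hA : 1 ≤ A.dim) :
    (mumfordTateGroup A.dim A.X).map
        (Pi.evalMonoidHom (fun k : ℕ ↦ complexBetti A.X k ≃ₗ[ℂ] complexBetti A.X k) 1) ⊓
        unitaryCentralizerGroup A h = hodgeGroupOne A.dim A.X :=
  map_mumfordTateGroup_inf_eq_hodgeGroupOne_of_le hA
    (hodgeGroupOne_le_unitaryCentralizerGroup (mem_hodgeClassSpan_one_of_isKaehlerClass_smul hQ hs hK))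
    fun _ hc ↦ (smulOfUnit_mem_unitaryCentralizerGroup_iff_of_isKaehlerClass hs hK hA).1 hc

variable (A) in
/-- Every complex abelian variety carries a rational Kähler class (the class of a hyperplane section in a
projective embedding; the tree's `KaehlerRationalDatum`). [cite: VoisinHodgeI2002, §7.1.2]
[cite: Milne1999LefschetzClasses, §4 p. 658 (an ample divisor D)] -/
private theorem exists_isRationalClass_isKaehlerClass_smul :
    ∃ h : complexBetti A.X 2, IsRationalClass h ∧ ∃ s : ℝ, 0 < s ∧ IsKaehlerClass A.dim A.X ((s : ℂ) • h) := by
  obtain ⟨D⟩ := nonempty_kaehlerRationalDatum (AbelianVariety.isSmoothProjective_holds (A := A))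
  refine ⟨D.Hη, D.isRationalClass_Hη, 1, one_pos, ?_⟩
  rw [Complex.ofReal_one, one_smul]
  exact D.isKaehlerClassVia.isKaehlerClass D.isNatural D.isMultiplicative

/-- **`MT(A)(ℂ)|_{H¹} ⊓ {g₁ | g ∈ ker l(A)(ℂ)} = Hg(A)(ℂ)|_{H¹}` for every complex abelian variety of positive
dimension** — no polarization in the statement: `{g₁ | g ∈ ker l(A)(ℂ)} = S(A)(ℂ)` for any polarization (the tree's
PROVED Thm. 4.4 record `Milne1999_thm44_specialLefschetzGroup_one_eq_unitaryCentralizerGroup_holds`).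
[cite: Milne1999LefschetzClasses, Thm. 4.4, §4 pp. 659–660 and Prop. 4.8] -/
theorem map_mumfordTateGroup_inf_map_specialLefschetzGroup_eq_hodgeGroupOne (hA : 1 ≤ A.dim) :
    (mumfordTateGroup A.dim A.X).map
        (Pi.evalMonoidHom (fun k : ℕ ↦ complexBetti A.X k ≃ₗ[ℂ] complexBetti A.X k) 1) ⊓
      (specialLefschetzGroup A.dim A.X).map
        (Pi.evalMonoidHom (fun k : ℕ ↦ complexBetti A.X k ≃ₗ[ℂ] complexBetti A.X k) 1) =
      hodgeGroupOne A.dim A.X := by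
  obtain ⟨h, hQ, s, hs, hK⟩ := exists_isRationalClass_isKaehlerClass_smul A
  rw [Milne1999_thm44_specialLefschetzGroup_one_eq_unitaryCentralizerGroup_holds A h hQ ⟨s, hs, hK⟩]
  exact map_mumfordTateGroup_inf_unitaryCentralizerGroup_eq_hodgeGroupOne_of_isKaehlerClass hQ hs.ne' hK hA

/-- **`MT(A)(ℂ)|_{H¹} ⊔ {g₁ | g ∈ ker l(A)(ℂ)} = L(A)(ℂ)|_{H¹}`** for every complex abelian variety (`L = MT · ker l`
restricted to `H¹`). [cite: Milne1999LefschetzClasses, §4 p. 659 (L = w·ker l) and p. 660 (L(A) ⊃ Hg(A))] -/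
theorem map_mumfordTateGroup_sup_map_specialLefschetzGroup_eq_map_lefschetzGroup :
    (mumfordTateGroup A.dim A.X).map
        (Pi.evalMonoidHom (fun k : ℕ ↦ complexBetti A.X k ≃ₗ[ℂ] complexBetti A.X k) 1) ⊔
      (specialLefschetzGroup A.dim A.X).map
        (Pi.evalMonoidHom (fun k : ℕ ↦ complexBetti A.X k ≃ₗ[ℂ] complexBetti A.X k) 1) =
      (lefschetzGroup A.dim A.X).map
        (Pi.evalMonoidHom (fun k : ℕ ↦ complexBetti A.X k ≃ₗ[ℂ] complexBetti A.X k) 1) := by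
  rw [← Subgroup.map_sup,
    mumfordTateGroup_sup_specialLefschetzGroup_eq_lefschetzGroup (AbelianVariety.isSmoothProjective_holds (A := A))]

/-- **`{g₁ | g ∈ ker l(A)(ℂ)} ≤ MT(A)(ℂ)|_{H¹} ⟺ Hg(A)(ℂ)|_{H¹} = {g₁ | g ∈ ker l(A)(ℂ)}`** (`dim A ≥ 1`): Prop. 4.8 (c)
read on `H¹`. [cite: Milne1999LefschetzClasses, Prop. 4.8 (p. 660) and Thm. 4.4] -/
theorem map_specialLefschetzGroup_le_map_mumfordTateGroup_iff (hA : 1 ≤ A.dim) :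
    (specialLefschetzGroup A.dim A.X).map
        (Pi.evalMonoidHom (fun k : ℕ ↦ complexBetti A.X k ≃ₗ[ℂ] complexBetti A.X k) 1) ≤
      (mumfordTateGroup A.dim A.X).map
        (Pi.evalMonoidHom (fun k : ℕ ↦ complexBetti A.X k ≃ₗ[ℂ] complexBetti A.X k) 1) ↔
      hodgeGroupOne A.dim A.X = (specialLefschetzGroup A.dim A.X).map
        (Pi.evalMonoidHom (fun k : ℕ ↦ complexBetti A.X k ≃ₗ[ℂ] complexBetti A.X k) 1) := by
  constructor
  · intro hle
    rw [← map_mumfordTateGroup_inf_map_specialLefschetzGroup_eq_hodgeGroupOne hA]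
    exact inf_eq_right.2 hle
  · intro heq
    rw [← heq]
    exact hodgeGroupOne_le_map_mumfordTateGroup

/-- **`MT(A)(ℂ)|_{H¹} ⊔ S(A)(ℂ) = G(A)(ℂ)`** for every complex abelian variety and every `h ∈ B¹(A) ⊗ ℂ`
(`G(A)(ℂ) = ℂˣ · S(A)(ℂ)`, the scalars lie in `MT(A)(ℂ)|_{H¹}`, and `MT|_{H¹} ≤ G(A)`).
[cite: Milne1999LefschetzClasses, §4 p. 659 (G(A), w, L = w·ker l) and p. 660 (L(A) ⊃ Hg(A))] -/
theorem map_mumfordTateGroup_sup_unitaryCentralizerGroup_eq_similitudeCentralizerGroup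
    (hh : h ∈ hodgeClassSpan A.dim A.X 1) :
    (mumfordTateGroup A.dim A.X).map
        (Pi.evalMonoidHom (fun k : ℕ ↦ complexBetti A.X k ≃ₗ[ℂ] complexBetti A.X k) 1) ⊔
        unitaryCentralizerGroup A h = similitudeCentralizerGroup A h := by
  refine le_antisymm (sup_le (mumfordTateGroup_map_one_le_similitudeCentralizerGroup hh)
    unitaryCentralizerGroup_le_similitudeCentralizerGroup) ?_
  intro u hu
  obtain ⟨c, u', hu', rfl⟩ := mem_similitudeCentralizerGroup_iff_exists_smulOfUnit_mul.1 hu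
  exact Subgroup.mul_mem _ (Subgroup.mem_sup_left (smulOfUnit_mem_map_mumfordTateGroup c))
    (Subgroup.mem_sup_right hu')

/-- **`MT(A)(ℂ)|_{H¹} ⊔ S(A)(ℂ) = L(A)(ℂ)|_{H¹}`** for a polarization class `h` (rational, `s · h` Kähler, `s > 0`):
`L(A)|_{H¹} = ℂˣ · S(A)(ℂ)` (Thm. 4.4 on `H¹`) and the scalars lie in `MT(A)(ℂ)|_{H¹}`.
[cite: Milne1999LefschetzClasses, Thm. 4.4, §4 p. 659 (L = w·ker l) and p. 660 (L(A) ⊃ Hg(A))] -/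
theorem map_mumfordTateGroup_sup_unitaryCentralizerGroup_eq_lefschetzGroup_map_one (hQ : IsRationalClass h)
    (hK : ∃ s : ℝ, 0 < s ∧ IsKaehlerClass A.dim A.X ((s : ℂ) • h)) :
    (mumfordTateGroup A.dim A.X).map
        (Pi.evalMonoidHom (fun k : ℕ ↦ complexBetti A.X k ≃ₗ[ℂ] complexBetti A.X k) 1) ⊔
        unitaryCentralizerGroup A h =
      (lefschetzGroup A.dim A.X).map
        (Pi.evalMonoidHom (fun k : ℕ ↦ complexBetti A.X k ≃ₗ[ℂ] complexBetti A.X k) 1) := by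
  refine le_antisymm (sup_le mumfordTateGroup_map_one_le_lefschetzGroup_map_one
    (unitaryCentralizerGroup_le_lefschetzGroup_map_one hQ hK)) ?_
  intro u hu
  obtain ⟨c, u', hu', rfl⟩ := (mem_map_lefschetzGroup_one_iff hQ hK).1 hu
  exact Subgroup.mul_mem _ (Subgroup.mem_sup_left (smulOfUnit_mem_map_mumfordTateGroup c))
    (Subgroup.mem_sup_right hu')

/-- **`S(A)(ℂ) ≤ MT(A)(ℂ)|_{H¹} ⟺ Hg(A)(ℂ)|_{H¹} = S(A)(ℂ)`** (polarization class `h`, `dim A ≥ 1`): Prop. 4.8 (c)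
on `H¹` as a lattice statement. [cite: Milne1999LefschetzClasses, Prop. 4.8 (p. 660)] -/
theorem unitaryCentralizerGroup_le_map_mumfordTateGroup_iff (hpol : IsPolarizationClass A.dim A.X h)
    (hA : 1 ≤ A.dim) :
    unitaryCentralizerGroup A h ≤ (mumfordTateGroup A.dim A.X).map
        (Pi.evalMonoidHom (fun k : ℕ ↦ complexBetti A.X k ≃ₗ[ℂ] complexBetti A.X k) 1) ↔
      hodgeGroupOne A.dim A.X = unitaryCentralizerGroup A h := by
  constructor
  · intro hle
    rw [← map_mumfordTateGroup_inf_unitaryCentralizerGroup_eq_hodgeGroupOne hpol hA]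
    exact inf_eq_right.2 hle
  · intro heq
    rw [← heq]
    exact hodgeGroupOne_le_map_mumfordTateGroup

/-- **`MT(A)(ℂ)|_{H¹} = G(A)(ℂ) ⟺ Hg(A)(ℂ)|_{H¹} = S(A)(ℂ)`** (polarization class `h`, `dim A ≥ 1`): Milne's
Prop. 4.8 (b) ⟺ (c) read on `H¹` — both from the square `Hg|_{H¹} = MT|_{H¹} ⊓ S(A)`, `G(A) = MT|_{H¹} ⊔ S(A)`.
[cite: Milne1999LefschetzClasses, Prop. 4.8 (p. 660) and Thm. 4.4] -/
theorem map_mumfordTateGroup_eq_similitudeCentralizerGroup_iff (hpol : IsPolarizationClass A.dim A.X h)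
    (hA : 1 ≤ A.dim) :
    (mumfordTateGroup A.dim A.X).map
        (Pi.evalMonoidHom (fun k : ℕ ↦ complexBetti A.X k ≃ₗ[ℂ] complexBetti A.X k) 1) =
        similitudeCentralizerGroup A h ↔
      hodgeGroupOne A.dim A.X = unitaryCentralizerGroup A h := by
  rw [← unitaryCentralizerGroup_le_map_mumfordTateGroup_iff hpol hA,
    ← map_mumfordTateGroup_sup_unitaryCentralizerGroup_eq_similitudeCentralizerGroup hpol.mem_hodgeClassSpan_one,
    eq_comm, sup_eq_left]

end Literature.AlgebraicGeometry.Milne1999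

/-! ### §3 CM field `E`: `MT(A)(ℂ)|_{H¹} ⊓ U(φ)(ℂ) = Hg(A)(ℂ)|_{H¹}` for every `(A, η, h)`; `MT|_{H¹} ⊔ U(φ) = G(A)` for the general member -/

namespace Literature.AlgebraicGeometry.Deligne1982

variable {A : AbelianVariety ℂ} {η : A ⟶ A} {R : Polynomial ℤ} {e₀ k : ℕ} {h : complexBetti A.X 2}

/-- **`MT(A)(ℂ)|_{H¹} ⊓ U(φ)(ℂ) = Hg(A)(ℂ)|_{H¹}` FOR EVERY complex abelian variety `A` of positive dimension, every
`η ∈ End(A)` and every polarization class `h`** (`U(φ)(ℂ) = weilUnitaryGroupCM A η h`: commute with `η^*`, preserve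
`Q_h`): `Hg|_{H¹} ≤ S(A) ≤ U(φ)` and a scalar in `U(φ)(ℂ)` is `±1`. In particular «`Hg(A) = SU(φ)`» says exactly
«`MT(A)(ℂ)|_{H¹} ∩ U(φ)(ℂ) = SU(φ)(ℂ)`» — the pull-back of Milne's bottom row `GU(φ) ↪ L(A)` along `MT ↪ L`.
[cite: Milne2025AbelianMotivesCharP, §1.5 Example 1.17] [cite: Milne1999LefschetzClasses, §4 pp. 659–660 (l ∘ w = -2, L(A) ⊃ Hg(A))]
[cite: Deligne1982HodgeCycles, I Prop. 3.4 and §4] -/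
theorem map_mumfordTateGroup_inf_weilUnitaryGroupCM_eq_hodgeGroupOne (hpol : IsPolarizationClass A.dim A.X h)
    (hA : 1 ≤ A.dim) (η : A ⟶ A) :
    (mumfordTateGroup A.dim A.X).map
        (Pi.evalMonoidHom (fun k : ℕ ↦ complexBetti A.X k ≃ₗ[ℂ] complexBetti A.X k) 1) ⊓ weilUnitaryGroupCM A η h =
      hodgeGroupOne A.dim A.X :=
  map_mumfordTateGroup_inf_eq_hodgeGroupOne_of_le hA
    ((hodgeGroupOne_le_unitaryCentralizerGroup hpol.mem_hodgeClassSpan_one).trans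
      (unitaryCentralizerGroup_le_weilUnitaryGroupCM η h))
    fun _ hc ↦ (smulOfUnit_mem_weilUnitaryGroupCM_iff hpol hA η).1 hc

/-- **«`Hg(A) = SU(φ)`» ⟺ «`MT(A)(ℂ)|_{H¹} ⊓ U(φ)(ℂ) = SU(φ)(ℂ)`»** for every `(A, η, h)` (`h` a polarization
class, `dim A ≥ 1`) and every root polynomial `P`. [cite: Milne2025AbelianMotivesCharP, §1.5 Example 1.17]
[cite: Deligne1982HodgeCycles, §4 and Milne 2003 re-edition endnote 16] -/
theorem hasHodgeGroupSUCM_iff_map_mumfordTateGroup_inf_weilUnitaryGroupCM_eq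
    (hpol : IsPolarizationClass A.dim A.X h) (hA : 1 ≤ A.dim) {P : Polynomial ℤ} :
    HasHodgeGroupSUCM A η P h ↔
      (mumfordTateGroup A.dim A.X).map
          (Pi.evalMonoidHom (fun k : ℕ ↦ complexBetti A.X k ≃ₗ[ℂ] complexBetti A.X k) 1) ⊓ weilUnitaryGroupCM A η h =
        weilSpecialUnitaryGroupCM A η P h := by
  rw [hasHodgeGroupSUCM_iff, map_mumfordTateGroup_inf_weilUnitaryGroupCM_eq_hodgeGroupOne hpol hA η]

/-- **`U(φ)(ℂ) ≤ MT(A)(ℂ)|_{H¹} ⟺ Hg(A)(ℂ)|_{H¹} = U(φ)(ℂ)`** (every `(A, η, h)`, `h` a polarization class,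
`dim A ≥ 1`). [cite: Milne1999LefschetzClasses, Prop. 4.8 (p. 660)] [cite: Milne2025AbelianMotivesCharP, §1.5 Example 1.17] -/
theorem weilUnitaryGroupCM_le_map_mumfordTateGroup_iff (hpol : IsPolarizationClass A.dim A.X h) (hA : 1 ≤ A.dim)
    (η : A ⟶ A) :
    weilUnitaryGroupCM A η h ≤ (mumfordTateGroup A.dim A.X).map
        (Pi.evalMonoidHom (fun k : ℕ ↦ complexBetti A.X k ≃ₗ[ℂ] complexBetti A.X k) 1) ↔
      hodgeGroupOne A.dim A.X = weilUnitaryGroupCM A η h := by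
  constructor
  · intro hle
    rw [← map_mumfordTateGroup_inf_weilUnitaryGroupCM_eq_hodgeGroupOne hpol hA η]
    exact inf_eq_right.2 hle
  · intro heq
    rw [← heq]
    exact hodgeGroupOne_le_map_mumfordTateGroup

section CM

variable (hW : IsWeilTypeCM A η R e₀ k) (hpol : IsPolarizationClass A.dim A.X h) (hRos : IsRosatiCM A η h)

include hW hpol hRos in
/-- **For a CM-Weil abelian variety, `Hg(A)(ℂ)|_{H¹} ≠ U(φ)(ℂ)` and `U(φ)(ℂ) ⊄ MT(A)(ℂ)|_{H¹}`** through the square: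
`Hg|_{H¹} ≤ SU(φ) ⊊ U(φ)`. [cite: Milne2025AbelianMotivesCharP, §1.5 Example 1.17] [cite: Deligne1982HodgeCycles, §4 (4.4)] -/
theorem IsWeilTypeCM.hodgeGroupOne_ne_weilUnitaryGroupCM : hodgeGroupOne A.dim A.X ≠ weilUnitaryGroupCM A η h := by
  have hA : 1 ≤ A.dim := by have := hW.two_le_dim; omega
  exact fun heq ↦ hW.not_weilUnitaryGroupCM_le_map_mumfordTateGroup hpol hRos
    ((weilUnitaryGroupCM_le_map_mumfordTateGroup_iff hpol hA η).2 heq)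

include hW hpol hRos in
/-- **`MT(A)(ℂ)|_{H¹} ⊔ U(φ)(ℂ) = G(A)(ℂ)` FOR THE GENERAL CM-WEIL ABELIAN VARIETY** (`Hg(A) = SU(φ)`, `k ≥ 2`, where
`S(A)(ℂ) = U(φ)(ℂ)` and `G(A)(ℂ) = ℂˣ · U(φ)(ℂ)`): with `MT|_{H¹} ⊓ U(φ) = SU(φ)` this is the whole square
`SU(φ) ↪ MT(A)` over `GU(φ) ≅ L(A)` on `H¹`. [cite: Milne2025AbelianMotivesCharP, §1.5 Example 1.17]
[cite: Milne1999LefschetzClasses, §4 p. 659 (G(A), L = w·ker l) and Thm. 4.4] -/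
theorem IsWeilTypeCM.map_mumfordTateGroup_sup_weilUnitaryGroupCM_eq_similitudeCentralizerGroup_of_hodgeGroupSU
    (hk : 2 ≤ k) (hSU : HasHodgeGroupSUCM A η (R.comp (X ^ 2)) h) :
    (mumfordTateGroup A.dim A.X).map
        (Pi.evalMonoidHom (fun k : ℕ ↦ complexBetti A.X k ≃ₗ[ℂ] complexBetti A.X k) 1) ⊔ weilUnitaryGroupCM A η h =
      similitudeCentralizerGroup A h := by
  rw [← hW.unitaryCentralizerGroup_eq_weilUnitaryGroupCM_of_hodgeGroupSU hpol hRos hk hSU]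
  exact map_mumfordTateGroup_sup_unitaryCentralizerGroup_eq_similitudeCentralizerGroup hpol.mem_hodgeClassSpan_one

include hW hpol hRos in
/-- **`MT(A)(ℂ)|_{H¹} ⊔ U(φ)(ℂ) = L(A)(ℂ)|_{H¹}` for the general CM-Weil abelian variety** (`k ≥ 2`, `h` with a Kähler
multiple). [cite: Milne2025AbelianMotivesCharP, §1.5 Example 1.17] [cite: Milne1999LefschetzClasses, Thm. 4.4 and §4 p. 659] -/
theorem IsWeilTypeCM.map_mumfordTateGroup_sup_weilUnitaryGroupCM_eq_lefschetzGroup_map_one_of_hodgeGroupSU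
    (hK : ∃ s : ℝ, 0 < s ∧ IsKaehlerClass A.dim A.X ((s : ℂ) • h)) (hk : 2 ≤ k)
    (hSU : HasHodgeGroupSUCM A η (R.comp (X ^ 2)) h) :
    (mumfordTateGroup A.dim A.X).map
        (Pi.evalMonoidHom (fun k : ℕ ↦ complexBetti A.X k ≃ₗ[ℂ] complexBetti A.X k) 1) ⊔ weilUnitaryGroupCM A η h =
      (lefschetzGroup A.dim A.X).map
        (Pi.evalMonoidHom (fun k : ℕ ↦ complexBetti A.X k ≃ₗ[ℂ] complexBetti A.X k) 1) := by
  rw [← hW.unitaryCentralizerGroup_eq_weilUnitaryGroupCM_of_hodgeGroupSU hpol hRos hk hSU]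
  exact map_mumfordTateGroup_sup_unitaryCentralizerGroup_eq_lefschetzGroup_map_one hpol.isRationalClass hK

include hW hpol hRos in
/-- **The square for the general CM-Weil member, both identities at once** (`k ≥ 2`):
`MT|_{H¹} ⊓ U(φ) = SU(φ)` and `MT|_{H¹} ⊔ U(φ) = G(A)`. [cite: Milne2025AbelianMotivesCharP, §1.5 Example 1.17]
[cite: Milne1999LefschetzClasses, §4 pp. 659–660, Thm. 4.4 and Prop. 4.8] -/
theorem IsWeilTypeCM.mumfordTate_weilUnitary_square_of_hodgeGroupSU (hk : 2 ≤ k)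
    (hSU : HasHodgeGroupSUCM A η (R.comp (X ^ 2)) h) :
    (mumfordTateGroup A.dim A.X).map
          (Pi.evalMonoidHom (fun k : ℕ ↦ complexBetti A.X k ≃ₗ[ℂ] complexBetti A.X k) 1) ⊓ weilUnitaryGroupCM A η h =
        weilSpecialUnitaryGroupCM A η (R.comp (X ^ 2)) h ∧
      (mumfordTateGroup A.dim A.X).map
          (Pi.evalMonoidHom (fun k : ℕ ↦ complexBetti A.X k ≃ₗ[ℂ] complexBetti A.X k) 1) ⊔ weilUnitaryGroupCM A η h =
        similitudeCentralizerGroup A h :=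
  ⟨hW.map_mumfordTateGroup_inf_weilUnitaryGroupCM_eq_of_hodgeGroupSU hpol hSU,
    hW.map_mumfordTateGroup_sup_weilUnitaryGroupCM_eq_similitudeCentralizerGroup_of_hodgeGroupSU hpol hRos hk hSU⟩

end CM

end Literature.AlgebraicGeometry.Deligne1982

/-! ### §4 `K = ℚ(√-d)` (van Geemen's `U_H`, `SU_H`): scalars, `MT|_{H¹} ⊓ U_H = Hg|_{H¹}`, the square for the general member -/

namespace Literature.AlgebraicGeometry.VanGeemen1994

/-- The scalar automorphism `c · 1`, evaluated. [folklore] -/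
private theorem smulOfUnit_apply₂ {A : AbelianVariety ℂ} (c : ℂˣ) (x : complexBetti A.X 1) :
    LinearEquiv.smulOfUnit c x = (c : ℂ) • x := by
  simp [LinearEquiv.smulOfUnit, Units.smul_def]

/-- `det(c · 1 | ker(T - ε)) = c^{dim ker(T - ε)}`. [cite: vanGeemen1994HodgeAV, 6.9 and Lemma 6.10] -/
private theorem detOnEigenspace_smulOfUnit {A : AbelianVariety ℂ} (c : ℂˣ) {T : Module.End ℂ (complexBetti A.X 1)}
    (hc : ∀ x, LinearEquiv.smulOfUnit c (T x) = T (LinearEquiv.smulOfUnit c x)) (ε : ℂ) :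
    detOnEigenspace (LinearEquiv.smulOfUnit c) T hc ε = (c : ℂ) ^ Module.finrank ℂ (T.eigenspace ε) := by
  unfold detOnEigenspace
  have e : ((LinearEquiv.smulOfUnit c : complexBetti A.X 1 ≃ₗ[ℂ] complexBetti A.X 1) :
        complexBetti A.X 1 →ₗ[ℂ] complexBetti A.X 1).restrict (mapsTo_eigenspace_of_comm hc ε) =
      (c : ℂ) • LinearMap.id := by
    ext x
    rw [LinearMap.coe_restrict_apply, LinearMap.smul_apply, LinearMap.id_apply, Submodule.coe_smul,
      LinearEquiv.coe_coe, smulOfUnit_apply₂]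
  rw [e, LinearMap.det_smul, LinearMap.det_id, mul_one]

section Package

variable (A : AbelianVariety ℂ) (φ : A ⟶ A) (n d : ℕ) (e : ProjectiveEmbedding A.X)
  (a : complexBetti (projectiveSpace e.n ℂ) 2)

/-- **`c · 1 ∈ U_H(ℂ)` iff `c² = 1`** for the `K`-symmetrised hyperplane class `h_K = d·e^*a + φ^*e^*a` (`dim A = 2n`,
`n, d ≥ 1`, `a ≠ 0` rational): `Q_{h_K}(cx, cy) = c² Q_{h_K}(x, y)` and `Q_{h_K}` is non-degenerate (van Geemen
Lemma 5.2 (2), the tree's `eq_zero_of_forall_polarizationPairingOne_ksymm_eq_zero`). [cite: vanGeemen1994HodgeAV, Lemma 5.2 (2) and 6.9]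
[cite: Milne1999LefschetzClasses, §4 p. 659 (l ∘ w = -2)] -/
theorem smulOfUnit_mem_weilUnitaryGroup_iff (hn : 0 < n) (hd : 0 < d) (hA : A.dim = 2 * n)
    (ha : IsRationalClass a) (ha0 : a ≠ 0) {c : ℂˣ} :
    LinearEquiv.smulOfUnit c ∈ weilUnitaryGroup A φ n (hK d φ e a) ↔ (c : ℂ) ^ 2 = 1 := by
  classical
  constructor
  · rintro ⟨-, hQ⟩
    by_contra hc
    have hzero : ∀ x y, polarizationPairingOne A.X (hK d φ e a) (2 * n - 1) x y = 0 := by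
      intro x y
      have e1 := hQ x y
      rw [smulOfUnit_apply₂, smulOfUnit_apply₂, map_smul, map_smul, LinearMap.smul_apply, smul_smul, ← sq] at e1
      have e3 : ((c : ℂ) ^ 2 - 1) • polarizationPairingOne A.X (hK d φ e a) (2 * n - 1) x y = 0 := by
        rw [sub_smul, one_smul, e1, sub_self]
      exact (smul_eq_zero.1 e3).resolve_left (sub_ne_zero.2 hc)
    have hm : 1 ≤ 2 * n - 1 := by omega
    have hA' : A.dim = (2 * n - 1) + 1 := by omega
    haveI := finite_complexBetti_abelianVariety A 1
    have hV : Module.finrank ℂ (complexBetti A.X 1) = 2 * A.dim := AbelianVariety.finrank_complexBetti_one A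
    obtain ⟨x, hx⟩ : ∃ x : complexBetti A.X 1, x ≠ 0 := by
      by_contra hall
      haveI : Subsingleton (complexBetti A.X 1) :=
        subsingleton_of_forall_eq 0 fun x ↦ not_not.1 (not_exists.1 hall x)
      have h0 : Module.finrank ℂ (complexBetti A.X 1) = 0 := Module.finrank_zero_of_subsingleton
      omega
    exact hx (eq_zero_of_forall_polarizationPairingOne_ksymm_eq_zero hm hA' hd φ e ha ha0 fun y ↦ hzero x y)
  · intro hc
    refine ⟨fun x ↦ by rw [smulOfUnit_apply₂, smulOfUnit_apply₂, map_smul], fun x y ↦ ?_⟩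
    rw [smulOfUnit_apply₂, smulOfUnit_apply₂, map_smul, map_smul, LinearMap.smul_apply, smul_smul, ← sq, hc,
      one_smul]

/-- **`c · 1 ∈ SU_H(ℂ)` iff `c² = 1`** (`dim A = 2n`, `φ ≫ φ = -d`, `n, d ≥ 1`): the scalar `c` has determinant
`c^{2n} = (c²)ⁿ` on `W` and on `W̄` (both of dimension `2n`, van Geemen Lemma 6.10).
[cite: vanGeemen1994HodgeAV, 6.9 and Lemma 6.10] -/
theorem smulOfUnit_mem_weilSpecialUnitaryGroup_iff (hn : 0 < n) (hd : 0 < d) (hA : A.dim = 2 * n)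
    (hφ : φ ≫ φ = -(d • 𝟙 A)) (ha : IsRationalClass a) (ha0 : a ≠ 0) {c : ℂˣ} :
    LinearEquiv.smulOfUnit c ∈ weilSpecialUnitaryGroup A φ n d (hK d φ e a) ↔ (c : ℂ) ^ 2 = 1 := by
  constructor
  · exact fun hu ↦ (smulOfUnit_mem_weilUnitaryGroup_iff A φ n d e a hn hd hA ha ha0).1
      (weilSpecialUnitaryGroup_le_weilUnitaryGroup A φ n d _ hu)
  · intro hc
    obtain ⟨hcomm, hQ⟩ := (smulOfUnit_mem_weilUnitaryGroup_iff A φ n d e a hn hd hA ha ha0).2 hc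
    -- `dim W = dim W̄ = 2n`
    have hW : Module.finrank ℂ (Module.End.eigenspace (pullbackOne A φ) (Complex.I * (Real.sqrt d : ℂ))) = 2 * n :=
      finrank_eigW hd hφ hA
    have hWbar : Module.finrank ℂ (Module.End.eigenspace (pullbackOne A φ) (-(Complex.I * (Real.sqrt d : ℂ)))) =
        2 * n := by
      have h2 := finrank_eigenspace_eq_finrank_eigenspace_neg (A := A) hd hφ
      change Module.finrank ℂ (Module.End.eigenspace (pullbackOne A φ) _) =
        Module.finrank ℂ (Module.End.eigenspace (pullbackOne A φ) _) at h2
      omega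
    refine ⟨hcomm, hQ, ?_, ?_⟩
    · rw [detOnEigenspace_smulOfUnit c hcomm, hW, pow_mul, hc, one_pow]
    · rw [detOnEigenspace_smulOfUnit c hcomm, hWbar, pow_mul, hc, one_pow]

/-- `-1 ∈ SU_H(ℂ)`. [cite: vanGeemen1994HodgeAV, 6.9 and Lemma 6.10] -/
theorem smulOfUnit_neg_one_mem_weilSpecialUnitaryGroup (hn : 0 < n) (hd : 0 < d) (hA : A.dim = 2 * n)
    (hφ : φ ≫ φ = -(d • 𝟙 A)) (ha : IsRationalClass a) (ha0 : a ≠ 0) :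
    LinearEquiv.smulOfUnit (-1 : ℂˣ) ∈ weilSpecialUnitaryGroup A φ n d (hK d φ e a) :=
  (smulOfUnit_mem_weilSpecialUnitaryGroup_iff A φ n d e a hn hd hA hφ ha ha0).2 (by simp)

/-- **`MT(A)(ℂ)|_{H¹} ⊓ U_H(ℂ) = Hg(A)(ℂ)|_{H¹}` FOR EVERY `(A, φ, h_K)` with `dim A = 2n`, `n ≥ 2`, `d ≥ 1`** (no
Weil-type hypothesis): `Hg|_{H¹} ≤ S(A)(h_K) ≤ U_H` and a scalar in `U_H(ℂ)` is `±1 ∈ Hg|_{H¹}`. Hence for an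
abelian variety of Weil type `MT|_{H¹} ∩ U_H ⊆ SU_H`, with equality EXACTLY for van Geemen's general member
(`Hg = SU_H`). [cite: vanGeemen1994HodgeAV, 6.9, Lemma 6.10 and Thm. 6.11] [cite: Milne2025AbelianMotivesCharP, §1.5 Example 1.17]
[cite: Milne1999LefschetzClasses, §4 pp. 659–660 (l ∘ w = -2, L(A) ⊃ Hg(A))] -/
theorem map_mumfordTateGroup_inf_weilUnitaryGroup_eq_hodgeGroupOne (hn : 2 ≤ n) (hd : 0 < d) (hA : A.dim = 2 * n)
    (ha : IsRationalClass a) (ha0 : a ≠ 0) :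
    (mumfordTateGroup A.dim A.X).map
        (Pi.evalMonoidHom (fun k : ℕ ↦ complexBetti A.X k ≃ₗ[ℂ] complexBetti A.X k) 1) ⊓
        weilUnitaryGroup A φ n (hK d φ e a) = hodgeGroupOne A.dim A.X :=
  map_mumfordTateGroup_inf_eq_hodgeGroupOne_of_le (by omega)
    ((hodgeGroupOne_le_unitaryCentralizerGroup (hK_mem_hodgeClassSpan hn hd hA e ha ha0)).trans
      (unitaryCentralizerGroup_le_weilUnitaryGroup A φ n hA _))
    fun _ hc ↦ (smulOfUnit_mem_weilUnitaryGroup_iff A φ n d e a (by omega) hd hA ha ha0).1 hc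

variable {A φ n} in
/-- **`MT(A)(ℂ)|_{H¹} ⊓ U_H(ℂ) = Hg(A)(ℂ)|_{H¹}` for `U_H` of ANY polarization class `h`** (`dim A = 2n`, `n ≥ 1`;
`U_h(ℂ) = weilUnitaryGroup A φ n h = weilUnitaryGroupCM A φ h`). [cite: vanGeemen1994HodgeAV, 6.9 and Thm. 6.11]
[cite: Milne1999LefschetzClasses, §4 pp. 659–660] -/
theorem map_mumfordTateGroup_inf_weilUnitaryGroup_eq_hodgeGroupOne_of_isPolarizationClass (hn : 0 < n)
    (hA : A.dim = 2 * n) {h : complexBetti A.X 2} (hpol : IsPolarizationClass A.dim A.X h) :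
    (mumfordTateGroup A.dim A.X).map
        (Pi.evalMonoidHom (fun k : ℕ ↦ complexBetti A.X k ≃ₗ[ℂ] complexBetti A.X k) 1) ⊓ weilUnitaryGroup A φ n h =
      hodgeGroupOne A.dim A.X := by
  rw [← weilUnitaryGroupCM_eq_weilUnitaryGroup hA]
  exact map_mumfordTateGroup_inf_weilUnitaryGroupCM_eq_hodgeGroupOne hpol (by omega) φ

/-- **For an abelian variety of Weil type, `MT(A)(ℂ)|_{H¹} ⊓ U_H(ℂ) ≤ SU_H(ℂ)`** (`n ≥ 2`; the Weil classes of
Hodge type `(n,n)` give `Hg|_{H¹} ≤ SU_H`, van Geemen's first step of Thm. 6.11).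
[cite: vanGeemen1994HodgeAV, proof of Thm. 6.11 (first step), 6.9–6.10] [cite: Milne2025AbelianMotivesCharP, §1.5 Example 1.17] -/
theorem map_mumfordTateGroup_inf_weilUnitaryGroup_le_weilSpecialUnitaryGroup (hn : 2 ≤ n) (hd : 0 < d)
    (hA : A.dim = 2 * n) (hφ : φ ≫ φ = -(d • 𝟙 A))
    (hW : ∀ c ∈ weilClassesOf A φ n d, IsOfHodgeType (2 * n) A.X (2 * n) n n c) (ha : IsRationalClass a)
    (ha0 : a ≠ 0) :
    (mumfordTateGroup A.dim A.X).map
        (Pi.evalMonoidHom (fun k : ℕ ↦ complexBetti A.X k ≃ₗ[ℂ] complexBetti A.X k) 1) ⊓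
        weilUnitaryGroup A φ n (hK d φ e a) ≤ weilSpecialUnitaryGroup A φ n d (hK d φ e a) := by
  rw [map_mumfordTateGroup_inf_weilUnitaryGroup_eq_hodgeGroupOne A φ n d e a hn hd hA ha ha0]
  exact hodgeGroupOne_le_weilSpecialUnitaryGroup (by omega) hd hA hφ hW (hK_mem_hodgeClassSpan hn hd hA e ha ha0)

/-- **«`Hg = SU_H`» ⟺ «`MT(A)(ℂ)|_{H¹} ⊓ U_H(ℂ) = SU_H(ℂ)`»** (`dim A = 2n`, `n ≥ 2`, `d ≥ 1`): van Geemen's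
general member is characterised by the top row of Milne's square being the pull-back of the bottom row.
[cite: vanGeemen1994HodgeAV, Thm. 6.11] [cite: Milne2025AbelianMotivesCharP, §1.5 Example 1.17] -/
theorem hasHodgeGroupSU_iff_map_mumfordTateGroup_inf_weilUnitaryGroup_eq (hn : 2 ≤ n) (hd : 0 < d)
    (hA : A.dim = 2 * n) (ha : IsRationalClass a) (ha0 : a ≠ 0) :
    HasHodgeGroupSU A φ n d (hK d φ e a) ↔
      (mumfordTateGroup A.dim A.X).map
          (Pi.evalMonoidHom (fun k : ℕ ↦ complexBetti A.X k ≃ₗ[ℂ] complexBetti A.X k) 1) ⊓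
          weilUnitaryGroup A φ n (hK d φ e a) = weilSpecialUnitaryGroup A φ n d (hK d φ e a) := by
  rw [hasHodgeGroupSU_iff, map_mumfordTateGroup_inf_weilUnitaryGroup_eq_hodgeGroupOne A φ n d e a hn hd hA ha ha0]

/-- **`MT(A)(ℂ)|_{H¹} ⊓ U_H(ℂ) = SU_H(ℂ)` for van Geemen's general Weil-type abelian variety** (`Hg = SU_H`, `n ≥ 2`).
[cite: vanGeemen1994HodgeAV, Thm. 6.11] [cite: Milne2025AbelianMotivesCharP, §1.5 Example 1.17] -/
theorem map_mumfordTateGroup_inf_weilUnitaryGroup_eq_of_hasHodgeGroupSU (hn : 2 ≤ n) (hd : 0 < d)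
    (hA : A.dim = 2 * n) (ha : IsRationalClass a) (ha0 : a ≠ 0) (hSU : HasHodgeGroupSU A φ n d (hK d φ e a)) :
    (mumfordTateGroup A.dim A.X).map
        (Pi.evalMonoidHom (fun k : ℕ ↦ complexBetti A.X k ≃ₗ[ℂ] complexBetti A.X k) 1) ⊓
        weilUnitaryGroup A φ n (hK d φ e a) = weilSpecialUnitaryGroup A φ n d (hK d φ e a) :=
  (hasHodgeGroupSU_iff_map_mumfordTateGroup_inf_weilUnitaryGroup_eq A φ n d e a hn hd hA ha ha0).1 hSU

/-- **`U_H(ℂ) ≤ MT(A)(ℂ)|_{H¹} ⟺ Hg(A)(ℂ)|_{H¹} = U_H(ℂ)`** (`dim A = 2n`, `n ≥ 2`) — which never happens for an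
abelian variety of Weil type (`Hg|_{H¹} ≤ SU_H ⊊ U_H`, the tree's `not_weilUnitaryGroup_le_map_mumfordTateGroup`).
[cite: vanGeemen1994HodgeAV, 6.9–6.11] [cite: Milne1999LefschetzClasses, Prop. 4.8 (p. 660)] -/
theorem weilUnitaryGroup_le_map_mumfordTateGroup_iff (hn : 2 ≤ n) (hd : 0 < d) (hA : A.dim = 2 * n)
    (ha : IsRationalClass a) (ha0 : a ≠ 0) :
    weilUnitaryGroup A φ n (hK d φ e a) ≤ (mumfordTateGroup A.dim A.X).map
        (Pi.evalMonoidHom (fun k : ℕ ↦ complexBetti A.X k ≃ₗ[ℂ] complexBetti A.X k) 1) ↔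
      hodgeGroupOne A.dim A.X = weilUnitaryGroup A φ n (hK d φ e a) := by
  constructor
  · intro hle
    rw [← map_mumfordTateGroup_inf_weilUnitaryGroup_eq_hodgeGroupOne A φ n d e a hn hd hA ha ha0]
    exact inf_eq_right.2 hle
  · intro heq
    rw [← heq]
    exact hodgeGroupOne_le_map_mumfordTateGroup

/-- **`Hg(A)(ℂ)|_{H¹} ≠ U_H(ℂ)` for every abelian variety of Weil type** (`n ≥ 2`).
[cite: vanGeemen1994HodgeAV, 6.9–6.11] [cite: Milne2025AbelianMotivesCharP, §1.5 Example 1.17] -/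
theorem hodgeGroupOne_ne_weilUnitaryGroup (hn : 2 ≤ n) (hd : 0 < d) (hA : A.dim = 2 * n)
    (hφ : φ ≫ φ = -(d • 𝟙 A)) (hW : ∀ c ∈ weilClassesOf A φ n d, IsOfHodgeType (2 * n) A.X (2 * n) n n c)
    (ha : IsRationalClass a) (ha0 : a ≠ 0) :
    hodgeGroupOne A.dim A.X ≠ weilUnitaryGroup A φ n (hK d φ e a) :=
  fun heq ↦ not_weilUnitaryGroup_le_map_mumfordTateGroup A φ n d e a hn hd hA hφ hW ha ha0
    ((weilUnitaryGroup_le_map_mumfordTateGroup_iff A φ n d e a hn hd hA ha ha0).2 heq)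

/-- **`MT(A)(ℂ)|_{H¹} ⊔ U_H(ℂ) = G(A)(ℂ)` for van Geemen's general Weil-type abelian variety** (`Hg = SU_H`, `n ≥ 2`;
`S(A)(h_K)(ℂ) = U_H(ℂ)`, `G(A)(ℂ) = ℂˣ · U_H(ℂ)`) — the bottom row `GU_H ≅ L(A)` is generated by the top row and
`U_H`. [cite: Milne2025AbelianMotivesCharP, §1.5 Example 1.17] [cite: Milne1999LefschetzClasses, §4 p. 659 and Thm. 4.4]
[cite: vanGeemen1994HodgeAV, 6.9 and Thm. 6.11] -/
theorem map_mumfordTateGroup_sup_weilUnitaryGroup_eq_similitudeCentralizerGroup_of_hasHodgeGroupSU (hn : 2 ≤ n)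
    (hd : 0 < d) (hA : A.dim = 2 * n) (hφ : φ ≫ φ = -(d • 𝟙 A)) (ha : IsRationalClass a) (ha0 : a ≠ 0)
    (hSU : HasHodgeGroupSU A φ n d (hK d φ e a)) :
    (mumfordTateGroup A.dim A.X).map
        (Pi.evalMonoidHom (fun k : ℕ ↦ complexBetti A.X k ≃ₗ[ℂ] complexBetti A.X k) 1) ⊔
        weilUnitaryGroup A φ n (hK d φ e a) = similitudeCentralizerGroup A (hK d φ e a) := by
  rw [← unitaryCentralizerGroup_eq_weilUnitaryGroup_of_hasHodgeGroupSU A φ n d e a hn hd hA hφ ha ha0 hSU]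
  exact map_mumfordTateGroup_sup_unitaryCentralizerGroup_eq_similitudeCentralizerGroup
    (hK_mem_hodgeClassSpan hn hd hA e ha ha0)

/-- **`MT(A)(ℂ)|_{H¹} ⊔ U_H(ℂ) = L(A)(ℂ)|_{H¹}` for van Geemen's general member** when `h_K` has a Kähler multiple.
[cite: Milne2025AbelianMotivesCharP, §1.5 Example 1.17] [cite: Milne1999LefschetzClasses, Thm. 4.4 and §4 p. 659] -/
theorem map_mumfordTateGroup_sup_weilUnitaryGroup_eq_lefschetzGroup_map_one_of_hasHodgeGroupSU (hn : 2 ≤ n)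
    (hd : 0 < d) (hA : A.dim = 2 * n) (hφ : φ ≫ φ = -(d • 𝟙 A)) (ha : IsRationalClass a) (ha0 : a ≠ 0)
    (hSU : HasHodgeGroupSU A φ n d (hK d φ e a))
    (hKae : ∃ s : ℝ, 0 < s ∧ IsKaehlerClass A.dim A.X ((s : ℂ) • hK d φ e a)) :
    (mumfordTateGroup A.dim A.X).map
        (Pi.evalMonoidHom (fun k : ℕ ↦ complexBetti A.X k ≃ₗ[ℂ] complexBetti A.X k) 1) ⊔
        weilUnitaryGroup A φ n (hK d φ e a) =
      (lefschetzGroup A.dim A.X).map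
        (Pi.evalMonoidHom (fun k : ℕ ↦ complexBetti A.X k ≃ₗ[ℂ] complexBetti A.X k) 1) := by
  rw [← unitaryCentralizerGroup_eq_weilUnitaryGroup_of_hasHodgeGroupSU A φ n d e a hn hd hA hφ ha ha0 hSU]
  exact map_mumfordTateGroup_sup_unitaryCentralizerGroup_eq_lefschetzGroup_map_one (isRationalClass_ksymm d φ e ha) hKae

/-- **The square for van Geemen's general member, both identities at once** (`n ≥ 2`):
`MT|_{H¹} ⊓ U_H = SU_H` and `MT|_{H¹} ⊔ U_H = G(A)`. [cite: Milne2025AbelianMotivesCharP, §1.5 Example 1.17]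
[cite: vanGeemen1994HodgeAV, 6.9 and Thm. 6.11] [cite: Milne1999LefschetzClasses, §4 pp. 659–660 and Thm. 4.4] -/
theorem mumfordTate_weilUnitary_square_of_hasHodgeGroupSU (hn : 2 ≤ n) (hd : 0 < d) (hA : A.dim = 2 * n)
    (hφ : φ ≫ φ = -(d • 𝟙 A)) (ha : IsRationalClass a) (ha0 : a ≠ 0) (hSU : HasHodgeGroupSU A φ n d (hK d φ e a)) :
    (mumfordTateGroup A.dim A.X).map
          (Pi.evalMonoidHom (fun k : ℕ ↦ complexBetti A.X k ≃ₗ[ℂ] complexBetti A.X k) 1) ⊓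
          weilUnitaryGroup A φ n (hK d φ e a) = weilSpecialUnitaryGroup A φ n d (hK d φ e a) ∧
      (mumfordTateGroup A.dim A.X).map
          (Pi.evalMonoidHom (fun k : ℕ ↦ complexBetti A.X k ≃ₗ[ℂ] complexBetti A.X k) 1) ⊔
          weilUnitaryGroup A φ n (hK d φ e a) = similitudeCentralizerGroup A (hK d φ e a) :=
  ⟨map_mumfordTateGroup_inf_weilUnitaryGroup_eq_of_hasHodgeGroupSU A φ n d e a hn hd hA ha ha0 hSU,
    map_mumfordTateGroup_sup_weilUnitaryGroup_eq_similitudeCentralizerGroup_of_hasHodgeGroupSU A φ n d e a hn hd hA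
      hφ ha ha0 hSU⟩

end Package

end Literature.AlgebraicGeometry.VanGeemen1994

end
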